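import Literature.Probability.RandomPlanarGeometry.WholePlaneRadialPiece
import Literature.Probability.RandomPlanarGeometry.RadialSLETrace
import HarnessLib

/-!
# The whole-plane curve from local radial generation of the increments (deterministic assembly)

Topic `Probability/RandomPlanarGeometry`; one definition with body (`WholePlaneLoewner.tip`) and
proved theorems (no named fact). Sequel of `WholePlaneLoewnerGluing` and `WholePlaneRadialPiece`:
the deterministic half of Miller–Sheffield (2013), proof of Prop. 2.5, in the local-in-time form
delivered by the radial theory of a random driving function (`RadialSLE.ae_locallyGeneratedSimple`).

* `WholePlaneLoewner.tip lam s = lim_{R ↓ 1} F_s(R e^{iλ_s})` — the **whole-plane tip** at time `s`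
  (a `limUnder`; the documented junk value when the limit does not exist);
* `WholePlaneLoewnerChain.isCurve_tip_of_locallyGeneratedSimple` — if every time `t` lies strictly
  inside a window `(b, b + h)` on which the radial chain of the increment driver
  `V_b(u) = λ(b + u) - λ_b` is locally generated by a curve staying inside the disc
  (`RadialSLE.LocallyGeneratedSimple (incr lam b) h`), then the tip limits exist at every time, the
  tip path is continuous, and the whole-plane Loewner chain is generated by it (`IsCurve`):
  the pieces `pieceCurve` are the tips (`tendsto_invMap_pieceCurve`), hence agree on overlaps and
  are continuous, and `isCurve_of_local_pieces` applies (`domain_shiftDriver_eq_component`,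
  `pieceCurve_notMem_hull`).

## References

* J. Miller, S. Sheffield, *Imaginary geometry IV*, PTRF 169 (2017), arXiv:1302.4738, Prop. 2.5
  (proof). [MillerSheffield2013]
* G. F. Lawler, *Conformally Invariant Processes in the Plane*, AMS (2005), §6.5–6.6. [Lawler2005]
-/

noncomputable section

open Set Filter Topology Metric Complex
open scoped NNReal

namespace Literature.Probability.RandomPlanarGeometry

/-- The **whole-plane tip** at time `s`: `lim_{R ↓ 1} F_s(R e^{iλ_s})` (junk value if the limit
does not exist). [cite: Lawler2005, §6.6] -/
def WholePlaneLoewner.tip (lam : ℝ → ℝ) (s : ℝ) : ℂ :=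
  limUnder (𝓝[>] (1 : ℝ)) fun R : ℝ ↦
    WholePlaneLoewner.BackwardFlow.invMap lam s ((R : ℂ) * Complex.exp ((lam s : ℝ) * Complex.I))

namespace WholePlaneLoewnerChain

variable {lam : ℝ → ℝ}

/-- **The whole-plane chain is generated by the tip path, from local radial generation of the
increments** (Miller–Sheffield (2013), proof of Prop. 2.5, deterministic part, local form).
[cite: MillerSheffield2013, Prop. 2.5 (proof)] -/
theorem isCurve_tip_of_locallyGeneratedSimple (C : WholePlaneLoewnerChain lam) (hlam : Continuous lam)
    (hloc : ∀ t : ℝ, ∃ b h : ℝ, b < t ∧ t < b + h ∧ RadialSLE.LocallyGeneratedSimple (incr lam b) h) :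
    C.IsCurve (WholePlaneLoewner.tip lam) ∧
      ∀ s : ℝ, Tendsto (fun R : ℝ ↦
        WholePlaneLoewner.BackwardFlow.invMap lam s ((R : ℂ) * Complex.exp ((lam s : ℝ) * Complex.I)))
        (𝓝[>] 1) (𝓝 (WholePlaneLoewner.tip lam s)) := by
  -- a piece around every time, with its radial curve
  have hpc : ∀ t : ℝ, ∃ (b : ℝ) (u₂ : ℝ≥0) (η : ℝ≥0 → ℂ), b < t ∧ t < b + u₂ ∧ Continuous η ∧ ‖η 0‖ = 1 ∧
      (∀ s : ℝ≥0, 0 < s → ‖η s‖ < 1) ∧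
      (∀ u : ℝ≥0, u ≤ u₂ → RadialLoewner.Disc.domain (incr lam b) u =
        connectedComponentIn (ball (0 : ℂ) 1 \ η '' Icc 0 u) 0) ∧
      (∀ u : ℝ≥0, u ≤ u₂ → Tendsto (fun r : ℝ ↦ Function.invFunOn (RadialLoewner.Disc.map (incr lam b) u)
        (RadialLoewner.Disc.domain (incr lam b) u) ((r : ℂ) * Complex.exp ((incr lam b u : ℝ) * Complex.I)))
        (𝓝[<] 1) (𝓝 (η u))) := by
    intro t
    obtain ⟨b, h, hbt, hth, hLG⟩ := hloc t
    set u₂ : ℝ≥0 := ⟨(t - b + h) / 2, by linarith⟩ with hu₂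
    have hu₂c : ((u₂ : ℝ≥0) : ℝ) = (t - b + h) / 2 := rfl
    have hu₂h : ((u₂ : ℝ≥0) : ℝ) < h := by rw [hu₂c]; linarith
    have hu₂pos : (0 : ℝ≥0) < u₂ := by rw [← NNReal.coe_pos, hu₂c]; linarith
    obtain ⟨η, hηc, hη0, -, hηlt, h5⟩ := hLG u₂ hu₂h
    refine ⟨b, u₂, η, hbt, by rw [hu₂c]; linarith, hηc, by rw [hη0, norm_one],
      fun s hs ↦ hηlt s hs hu₂pos, fun u hu ↦ (h5 u hu).1, fun u hu ↦ (h5 u hu).2⟩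
  -- the tip limits exist inside the pieces and are the piece curves
  have htip : ∀ {b : ℝ} {u₂ : ℝ≥0} {η : ℝ≥0 → ℂ}, (∀ s : ℝ≥0, 0 < s → ‖η s‖ < 1) →
      (∀ u : ℝ≥0, u ≤ u₂ → RadialLoewner.Disc.domain (incr lam b) u =
        connectedComponentIn (ball (0 : ℂ) 1 \ η '' Icc 0 u) 0) →
      (∀ u : ℝ≥0, u ≤ u₂ → Tendsto (fun r : ℝ ↦ Function.invFunOn (RadialLoewner.Disc.map (incr lam b) u)
        (RadialLoewner.Disc.domain (incr lam b) u) ((r : ℂ) * Complex.exp ((incr lam b u : ℝ) * Complex.I)))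
        (𝓝[<] 1) (𝓝 (η u))) →
      ∀ s ∈ Ioc b (b + u₂), WholePlaneLoewner.tip lam s = pieceCurve lam b η s := by
    intro b u₂ η hηlt hG ht s hs
    exact (tendsto_invMap_pieceCurve hηlt hG hlam ht hs).limUnder_eq
  -- the tip tendsto statement at every time
  have htend : ∀ s : ℝ, Tendsto (fun R : ℝ ↦
      WholePlaneLoewner.BackwardFlow.invMap lam s ((R : ℂ) * Complex.exp ((lam s : ℝ) * Complex.I)))
      (𝓝[>] 1) (𝓝 (WholePlaneLoewner.tip lam s)) := by
    intro s
    obtain ⟨b, u₂, η, hbs, hsu, -, -, hηlt, hG, ht⟩ := hpc s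
    have hs : s ∈ Ioc b (b + u₂) := ⟨hbs, hsu.le⟩
    rw [htip hηlt hG ht s hs]
    exact tendsto_invMap_pieceCurve hηlt hG hlam ht hs
  -- continuity of the tip path
  have hcont : Continuous (WholePlaneLoewner.tip lam) := by
    refine continuous_iff_continuousAt.2 fun t ↦ ?_
    obtain ⟨b, u₂, η, hbt, htu, hηc, -, hηlt, hG, ht⟩ := hpc t
    have hopen : Ioo b (b + u₂) ∈ 𝓝 t := isOpen_Ioo.mem_nhds ⟨hbt, htu⟩
    have h1 : ContinuousOn (pieceCurve lam b η) (Ioo b (b + u₂)) :=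
      (continuousOn_pieceCurve hηlt hG hlam hηc).mono Ioo_subset_Ioc_self
    have h2 : ContinuousOn (WholePlaneLoewner.tip lam) (Ioo b (b + u₂)) :=
      h1.congr fun s hs ↦ htip hηlt hG ht s (Ioo_subset_Ioc_self hs)
    exact h2.continuousAt hopen
  refine ⟨C.isCurve_of_local_pieces hlam hcont fun t ↦ ?_, htend⟩
  obtain ⟨b, u₂, η, hbt, htu, -, hη0, hηlt, hG, ht⟩ := hpc t
  refine ⟨b, u₂, hbt, htu, fun s hs ↦ ?_, fun u _ hu ↦ ?_⟩
  · rw [htip hηlt hG ht s (Ioo_subset_Ioc_self hs)]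
    exact pieceCurve_notMem_hull hηlt hG C hlam (Ioo_subset_Ioc_self hs)
  · have hu' : u ≤ u₂ := by exact_mod_cast hu.le
    rw [domain_shiftDriver_eq_component hηlt hG C hlam hη0 hu']
    congr 2
    refine image_congr fun s hs ↦ ?_
    have hs' : s ∈ Ioc b (b + u₂) := ⟨hs.1, hs.2.trans (by have := NNReal.coe_le_coe.2 hu'; linarith)⟩
    rw [htip hηlt hG ht s hs']
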